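import Summits.BirchSwinnertonDyer.BirchSwinnertonDyer.Theorems.ByReductionTypeAtTwoRankOneAtTwoOneDoorFirstDescentDefs
import Summits.BirchSwinnertonDyer.BirchSwinnertonDyer.Theorems.ByReductionTypeAtTwoRankOneAtTwoBigImageOddLocalOneDoorBottomLocalLines
import Summits.BirchSwinnertonDyer.BirchSwinnertonDyer.Theorems.ByReductionTypeAtTwoRankOneAtTwoBigImageOddLocalOneDoorBottomTranspositionCount
import Summits.BirchSwinnertonDyer.BirchSwinnertonDyer.Theorems.GenusKolyvaginAtTwoMazurRubinCor34iiDictionary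
import Summits.BirchSwinnertonDyer.BirchSwinnertonDyer.Theorems.GenusKolyvaginAtTwoGenusPrimitiveSupplyAtTwoArchimedeanKummerCard
import HarnessLib

/-!
# Route ByReductionTypeAtTwo, crux `RankOneAtTwoBigImageOddLocal` (stmt-BirchSwinnertonDyer-23715), LINE v8.9 `one_door_analytic`:
# the leaves `line₁`, `line₂` of `FirstDescentInput` in the lead's currency (`RatPlace`, `locAt`, `strictAt`, level `2`) — DISCHARGED

Width prover seat `bsd-line-fkl-p2` g10 (2026-08-28), `--supports stmt-BirchSwinnertonDyer-23715` (helper).  THEOREMS ONLY (no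
definition, no named fact, no `sorry`).  BSD is not proved by any of this.

The lead's input record `FirstDescentInput W Wd` (`Theorems/ByReductionTypeAtTwoRankOneAtTwoOneDoorFirstDescentDefs.lean`, p641630; skeleton
v8.9 `stub_firstDescentLeaves : FirstDescentLeavesAtTwoBottom`) displays the leaves of Kolyvagin's first `2`-descent over `ℚ` in the
currency `RatPlace = HeightOneSpectrum (𝓞 ℚ) ⊕ InfinitePlace ℚ`, `locAt X 2 v` (Kummer condition), `strictAt X 2 v` (strict condition),
level the literal `(2 : ℤ)`.  This file DISCHARGES the two ONE-LINE fields (Mazur–Rubin 2010 Lemma 2.2 (i)) at the error place of a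
minimal door, for BOTH signs of `Δ_W`, re-indexing the width seat's `…OneDoorBottomLocalLines.lean` (p641343) and
`…OneDoorBottomTranspositionCount.lean` (p642041):

* §1 `line_inl_of_card` — `line₁` / `line₂` at a FINITE error place `q₀ = Sum.inl v₀` from the count `#X(ℚ_{v₀})[2] = 2`, any `X/ℚ`;
* §2 the counts DISCHARGED at the TRANSPOSITION prime `q₀` of the door (`(Δ_min/q₀) = −1`, `q₀` odd good — the `Δ_W < 0` corner):
  `line₁_inl` for `W`, and `line₂_inl` for ANY model `Wd` of the twist `W^{(d)}` — `#Wd(ℚ_v)[2] = #W(ℚ_v)[2]` at every finite place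
  (`natCard_ker_nsmul_two_twist_adicCompletion_eq`: Mazur–Rubin Remark 2.4 `E^{(d)}[2] = E[2]` on `ℚ_v`-points, tree
  `GenusKolyTwistTamagawa.natCard_torsionBy_two_quadraticTwist`), although `Wd` has BAD reduction at `q₀ ∣ d`;
* §3 the ARCHIMEDEAN error place `q₀ = Sum.inr ∞` (the `Δ_W > 0` corner U₀⁺ of MEMO-es §18.11, Kramer's norm index at `∞`):
  `sub_mem_torsionLocalKer_inf_of_card_eq_two` (any number field, from `#𝓛_w = 2`) and `line_inr_of_Δ_pos` for any `X/ℚ` with `Δ_X > 0`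
  (`#𝓛_∞ = [E(ℝ) : 2E(ℝ)] = 2`, gk2's `GenusKolyArch.natCard_kummerSelmerStructure_inl_rat_eq_two_of_Δ_pos`, Kramer Prop. 6).

(The `rec₁`/`rec₂` fields are the sibling `…OneDoorBottomLeavesRec.lean`, over `…OneDoorBottomReciprocity.lean` p640864.)

References: [MazurRubin2010] Lemma 2.2 (i), Remark 2.4; [Kramer1981] Props. 3, 6; [GrossLMS1991] §10.
-/

set_option autoImplicit false
-- the Theorems namespace of this sub repeats the summit name by design (D-0017 nested layout)
set_option linter.dupNamespace false

noncomputable section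

open scoped Classical AddSubgroup

namespace Summit.BirchSwinnertonDyer.BirchSwinnertonDyer.Theorems.RankOneAtTwoOneDoor

open WeierstrassCurve NumberField IsDedekindDomain Field
open Literature.NumberTheory.EllipticCurves Literature.NumberTheory.GaloisRepresentations
open Literature.NumberTheory.GaloisCohomology
open Summit.BirchSwinnertonDyer.BirchSwinnertonDyer.Theorems.GenusExact

/-! ## §1 `line₁` / `line₂` at a finite error place from the local count -/

/-- **Field `line₁` / `line₂` of `FirstDescentInput` at `q₀ = Sum.inl v₀`** from `#X(ℚ_{v₀})[2] = 2` at an odd prime `q₀` (Mazur–Rubin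
Lemma 2.2 (i): the Kummer image at `q₀` is one line; `hline_at_of_card` re-indexed). [cite: MazurRubin2010, Lemma 2.2 (i)] -/
theorem line_inl_of_card (X : WeierstrassCurve ℚ) [X.IsElliptic] {q₀ : ℕ} [Fact q₀.Prime] (hq₀2 : q₀ ≠ 2)
    {v₀ : HeightOneSpectrum (𝓞 ℚ)} (hq₀v : (q₀ : 𝓞 ℚ) ∈ v₀.asIdeal)
    (hcard : Nat.card (nsmulAddMonoidHom 2 : (X.baseChange (v₀.adicCompletion ℚ)).toAffine.Point →+ _).ker = 2) :
    ∀ s t : galH1Torsion X 2, s ∈ locAt X 2 (Sum.inl v₀) → t ∈ locAt X 2 (Sum.inl v₀) →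
      s ∉ strictAt X 2 (Sum.inl v₀) → t ∉ strictAt X 2 (Sum.inl v₀) → s - t ∈ strictAt X 2 (Sum.inl v₀) :=
  fun s t hs ht hs0 ht0 => hline_at_of_card X hq₀2 hq₀v hcard s t hs ht hs0 ht0

/-! ## §2 The `line` counts at the transposition prime of the door -/

/-- **`line₁` for `W` at the TRANSPOSITION prime `q₀`** (`W` globally minimal, `q₀` odd good, `q₀ ∤ Δ_min`, `(Δ_min/q₀) = −1` — then
`#E(ℚ_{q₀})[2] = 2`, `natCard_ker_nsmul_adicCompletion_two_eq_two_of_jacobiSym`). [cite: MazurRubin2010, Lemma 2.2 (i)] [cite: Kramer1981, Prop. 3] -/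
theorem line₁_inl (W : WeierstrassCurve ℚ) [W.IsElliptic] [W.IsGloballyMinimal] {q₀ : ℕ} [Fact q₀.Prime] (hq₀2 : q₀ ≠ 2)
    (hgood : W.HasGoodReductionAtPrime q₀) (hqΔ : ¬ (q₀ : ℤ) ∣ W.Δ.num) (hjac : jacobiSym W.Δ.num q₀ = -1)
    {v₀ : HeightOneSpectrum (𝓞 ℚ)} (hq₀v : (q₀ : 𝓞 ℚ) ∈ v₀.asIdeal) :
    ∀ s t : galH1Torsion W 2, s ∈ locAt W 2 (Sum.inl v₀) → t ∈ locAt W 2 (Sum.inl v₀) →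
      s ∉ strictAt W 2 (Sum.inl v₀) → t ∉ strictAt W 2 (Sum.inl v₀) → s - t ∈ strictAt W 2 (Sum.inl v₀) :=
  line_inl_of_card W hq₀2 hq₀v (natCard_ker_nsmul_adicCompletion_two_eq_two_of_jacobiSym W hq₀2 hgood hqΔ hjac hq₀v)

/-- **`#Wd(ℚ_v)[2] = #W(ℚ_v)[2]` for any model `Wd = C • W^{(d)}` of a quadratic twist, at every finite place `v`** (also at the places of
bad reduction of the twist): base change commutes with the twist (`baseChange_quadraticTwist`), a change of variables preserves the point
group (`natCard_torsionBy_point_smul`), and over any field with `2 ≠ 0` the `2`-torsion of `E^{(d)}` and `E` correspond under `x ↦ d·x`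
(`GenusKolyTwistTamagawa.natCard_torsionBy_two_quadraticTwist`). [cite: MazurRubin2010, Remark 2.4 and Lemma 2.2 (i)] -/
theorem natCard_ker_nsmul_two_twist_adicCompletion_eq (W : WeierstrassCurve ℚ) [W.IsElliptic] {d : ℚ} (hd : d ≠ 0)
    {Wd : WeierstrassCurve ℚ} [Wd.IsElliptic] {C : VariableChange ℚ} (hWd : C • W.quadraticTwist d = Wd)
    (v : HeightOneSpectrum (𝓞 ℚ)) :
    Nat.card (nsmulAddMonoidHom 2 : (Wd.baseChange (v.adicCompletion ℚ)).toAffine.Point →+ _).ker =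
      Nat.card (nsmulAddMonoidHom 2 : (W.baseChange (v.adicCompletion ℚ)).toAffine.Point →+ _).ker := by
  haveI : (W.baseChange (v.adicCompletion ℚ)).IsElliptic :=
    inferInstanceAs (W.map (algebraMap ℚ (v.adicCompletion ℚ))).IsElliptic
  have hinj : Function.Injective (algebraMap ℚ (v.adicCompletion ℚ)) := (algebraMap ℚ (v.adicCompletion ℚ)).injective
  have hd' : algebraMap ℚ (v.adicCompletion ℚ) d ≠ 0 := (_root_.map_ne_zero _).mpr hd
  haveI : NeZero (2 : v.adicCompletion ℚ) := ⟨by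
    intro h
    have h2 : algebraMap ℚ (v.adicCompletion ℚ) 2 = algebraMap ℚ (v.adicCompletion ℚ) 0 := by rw [map_ofNat, map_zero]; exact h
    exact two_ne_zero (hinj h2)⟩
  have hker : ∀ (X : WeierstrassCurve (v.adicCompletion ℚ)),
      Nat.card (nsmulAddMonoidHom 2 : X.toAffine.Point →+ _).ker = Nat.card (X.toAffine.Point[(2 : ℤ)]) := by
    intro X
    refine Nat.card_congr (Equiv.subtypeEquivRight fun P => ?_)
    rw [AddMonoidHom.mem_ker, nsmulAddMonoidHom_apply, Submodule.mem_toAddSubgroup, Submodule.mem_torsionBy_iff, two_zsmul, two_nsmul]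
  rw [hker, hker, ← hWd, WeierstrassCurve.baseChange_smul_eq, natCard_torsionBy_point_smul, WeierstrassCurve.baseChange_quadraticTwist,
    GenusKolyTwistTamagawa.natCard_torsionBy_two_quadraticTwist _ hd']

/-- **`line₂` for a model `Wd` of the twist `W^{(d)}` at the TRANSPOSITION prime `q₀` of `W`** (hypotheses of `line₁_inl` plus
`C • W^{(d)} = Wd`, `d ≠ 0`): `#Wd(ℚ_{q₀})[2] = #W(ℚ_{q₀})[2] = 2`. [cite: MazurRubin2010, Lemma 2.2 (i) and Remark 2.4] [cite: Kramer1981, Prop. 3] -/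
theorem line₂_inl (W : WeierstrassCurve ℚ) [W.IsElliptic] [W.IsGloballyMinimal] {q₀ : ℕ} [Fact q₀.Prime] (hq₀2 : q₀ ≠ 2)
    (hgood : W.HasGoodReductionAtPrime q₀) (hqΔ : ¬ (q₀ : ℤ) ∣ W.Δ.num) (hjac : jacobiSym W.Δ.num q₀ = -1)
    {v₀ : HeightOneSpectrum (𝓞 ℚ)} (hq₀v : (q₀ : 𝓞 ℚ) ∈ v₀.asIdeal)
    {d : ℚ} (hd : d ≠ 0) (Wd : WeierstrassCurve ℚ) [Wd.IsElliptic] {C : VariableChange ℚ} (hWd : C • W.quadraticTwist d = Wd) :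
    ∀ s t : galH1Torsion Wd 2, s ∈ locAt Wd 2 (Sum.inl v₀) → t ∈ locAt Wd 2 (Sum.inl v₀) →
      s ∉ strictAt Wd 2 (Sum.inl v₀) → t ∉ strictAt Wd 2 (Sum.inl v₀) → s - t ∈ strictAt Wd 2 (Sum.inl v₀) := by
  refine line_inl_of_card Wd hq₀2 hq₀v ?_
  rw [natCard_ker_nsmul_two_twist_adicCompletion_eq W hd hWd v₀]
  exact natCard_ker_nsmul_adicCompletion_two_eq_two_of_jacobiSym W hq₀2 hgood hqΔ hjac hq₀v

/-! ## §3 The archimedean error place (`Δ > 0` corner): `line` at `q₀ = Sum.inr ∞` -/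

section Arch

universe u

variable {K : Type u} [Field K] [NumberField K] (Y : WeierstrassCurve K) [Y.IsElliptic]

/-- At an infinite place `w`: `s ∈ torsionLocalKer_w ↔ s_w = 0` (tree `mem_torsionLocalKer_iff_res_eq_zero`, `K_w` of characteristic `0`).
[cite: GrossLMS1991, Prop. 8.2] -/
theorem mem_torsionLocalKer_completion_iff (w : InfinitePlace K) {n : ℕ} (hn : n ≠ 0) (s : galH1Torsion Y (n : ℤ)) :
    s ∈ Y.torsionLocalKer w.Completion (n : ℤ) ↔
      galoisCohomology.localization (Y.torsionGaloisModule ((n : ℕ) : ℤ)) (Sum.inl w) 1 s = 0 := by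
  haveI : CharZero w.Completion := charZero_of_injective_algebraMap (algebraMap K w.Completion).injective
  exact mem_torsionLocalKer_iff_res_eq_zero Y w.Completion hn s

/-- **The one-line leaf at an INFINITE place from the count `#𝓛_w = 2`** (any number field): two classes in the Kummer condition at `w` with
non-zero localisations differ by a class with zero localisation (the Kummer structure `𝓛_w` receives Selmer classes,
`comap_localization_kummerSelmerStructure`). [cite: Kramer1981, Prop. 6] [cite: MazurRubin2010, Lemma 2.2] -/
theorem sub_mem_torsionLocalKer_inf_of_card_eq_two (w : InfinitePlace K)
    (hcard : Nat.card (Y.kummerSelmerStructure ((2 : ℕ) : ℤ) (Sum.inl w)) = 2)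
    {s t : galH1Torsion Y ((2 : ℕ) : ℤ)}
    (hs : s ∈ selmerLocalKer Y w.Completion ((2 : ℕ) : ℤ)) (ht : t ∈ selmerLocalKer Y w.Completion ((2 : ℕ) : ℤ))
    (hs0 : s ∉ Y.torsionLocalKer w.Completion ((2 : ℕ) : ℤ)) (ht0 : t ∉ Y.torsionLocalKer w.Completion ((2 : ℕ) : ℤ)) :
    s - t ∈ Y.torsionLocalKer w.Completion ((2 : ℕ) : ℤ) := by
  set loc := galoisCohomology.localization (Y.torsionGaloisModule ((2 : ℕ) : ℤ)) (Sum.inl w) 1 with hloc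
  set U := Y.kummerSelmerStructure ((2 : ℕ) : ℤ) (Sum.inl w) with hU
  have hmem : ∀ {x : galH1Torsion Y ((2 : ℕ) : ℤ)}, x ∈ selmerLocalKer Y w.Completion ((2 : ℕ) : ℤ) → loc x ∈ U := by
    intro x hx
    have hx' : x ∈ selmerLocalKer Y (Place.Completion (Sum.inl w)) ((2 : ℕ) : ℤ) := hx
    rw [← Y.comap_localization_kummerSelmerStructure ((2 : ℕ) : ℤ) (Sum.inl w)] at hx'
    exact hx'
  have hx0 : loc s ≠ 0 := fun h => hs0 ((mem_torsionLocalKer_completion_iff Y w two_ne_zero s).mpr h)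
  have hy0 : loc t ≠ 0 := fun h => ht0 ((mem_torsionLocalKer_completion_iff Y w two_ne_zero t).mpr h)
  have hxy : loc s = loc t := eq_of_mem_of_card_eq_two U hcard (hmem hs) (hmem ht) hx0 hy0
  have hst' : loc (s - t) = loc s - loc t := map_sub loc s t
  have hst : loc (s - t) = 0 := by rw [hst', hxy, sub_self]
  exact (mem_torsionLocalKer_completion_iff Y w two_ne_zero (s - t)).mpr hst

end Arch

/-- **Field `line₁` / `line₂` at the REAL error place** (`q₀ = Sum.inr w`, `Δ_X > 0`: `E(ℝ) ≅ S¹ × ℤ/2`, `[E(ℝ) : 2E(ℝ)] = 2`,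
gk2's `GenusKolyArch.natCard_kummerSelmerStructure_inl_rat_eq_two_of_Δ_pos`) — the U₀⁺ corner; for the twin use `0 < Wd.Δ`
(`Δ(E^{(d)}) = d⁶ Δ(E)` up to `u¹²`). [cite: Kramer1981, Prop. 6] [cite: MazurRubin2010, Lemma 2.2] -/
theorem line_inr_of_Δ_pos (X : WeierstrassCurve ℚ) [X.IsElliptic] (hΔ : 0 < X.Δ) (w : InfinitePlace ℚ) :
    ∀ s t : galH1Torsion X 2, s ∈ locAt X 2 (Sum.inr w) → t ∈ locAt X 2 (Sum.inr w) →
      s ∉ strictAt X 2 (Sum.inr w) → t ∉ strictAt X 2 (Sum.inr w) → s - t ∈ strictAt X 2 (Sum.inr w) :=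
  fun _ _ hs ht hs0 ht0 =>
    sub_mem_torsionLocalKer_inf_of_card_eq_two X w (GenusKolyArch.natCard_kummerSelmerStructure_inl_rat_eq_two_of_Δ_pos X hΔ w)
      hs ht hs0 ht0

end Summit.BirchSwinnertonDyer.BirchSwinnertonDyer.Theorems.RankOneAtTwoOneDoor

end
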